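import Literature.AnabelianGeometry.AbsoluteAnabelian.MonoidKummerMaps
import Literature.AnabelianGeometry.EtaleTheta.TemperedCoverings
import Summits.ABC.IUTFork.LanaLogTheta
import HarnessLib

/-!
# L-LANA objects IX bis: the log-link's "unique lifting" reduced to the reference datum, and to [AbsTopIII] Prop. 3.2 (iv) by name

Record-only file (D-0012) of the abc-iut cell (seat abc-iut-c312-4, L-LANA level, plan/LLANA-SPEC N12: "log-link
… with the lifting as INTERFACE"); TAKES NO SIDE on [IUTchIII] Cor. 3.12. CONSUMES layer L4's typed [AbsTopIII] §3
(seat abc-iut-L4-t2: `GaloisMonoidPair`, `IsMLFGaloisMonoidPair`, the NAMED facts `PairIsoDeterminedByGalois` and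
`GaloisIsoLiftsToTMPairIso` = [AbsTopIII] Prop. 3.2 (iv), injectivity resp. bijectivity of
`Isom((Π ↷ M_TM), (Π* ↷ M*_TM)) → Isom(Π, Π*)`) and layer L2's predicate `EtaleTheta.IsTopCharacteristic`.

LANA §5.3 (a) p. 29: "We fix an isomorphism `†HT^D ⥲ ‡HT^D` between the étale-like portions of the Hodge theaters
once for all. Then by the fact ([IUTchI, Cor. 5.3 (ii), p. 160]) that any isomorphism of `D`-prime strips can be
uniquely lifted to an isomorphism of `F`-prime strips, one obtains a unique lift `log : †K̄_v(logF) ⥲ ‡K̄_v`."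
`LanaLogTheta.lean` (gen 0) carries that fact as the model-relative HYPOTHESIS `UniqueLifting ref` on the
reference local data `ref : V → RefLocalDatum` (LANA's GROUP-LEVEL prime-strips, Rem. 3.10.1 p. 22: "`G_v` and
`D^⊢_v` are 'roughly equivalent data' … `F^{⊢×}_v` is … a certain Frobenioid whose data are equivalent to this
GM-data"). [IUTchI] Cor. 5.3 (ii) p. 144, proof: "Assertion (ii) … follows immediately from [AbsTopIII],
Proposition 3.2, (iv); [AbsTopIII], Proposition 4.2, (i)". THIS file makes the hypothesis TRANSPARENT:

* §1 `RefLocalDatum.LiftExists` / `LiftUnique` — the two halves of "unique lifting" FOR THE REFERENCE DATUM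
  `F_v = (Π_v ↷ O^▷_v)` ITSELF (every topological automorphism of `Π_v` extends to an automorphism of the GM-data
  `F_v`; an automorphism of `F_v` is determined by its `Π_v`-component);
* §2 **`uniqueLifting_iff_ref` (PROVED)** — `UniqueLifting ref ⟺ (∀ v, LiftExists (ref v)) ∧ (∀ v, LiftUnique
  (ref v))`: since every `F`-prime-strip is placewise a COPY of the reference family (§3.10 p. 23 "abstractly
  isomorphic to"), lifting along arbitrary strips is lifting at the reference datum conjugated by the copy
  isomorphisms — the group-level twin of L5-t4's `FKit.isomFtoDBijective_iff_model` for [IUTchI] Cor. 5.3 (ii)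
  (`Literature/IUT/HodgeTheaters/FPrimeStripsRigidity.lean`); and `LogLink.lift_unique_of_liftUnique` — the
  UNIQUENESS of the log-link over its étale isomorphism (all that `LogLink.lift_unique` uses) needs only the
  uniqueness half;
* §3 the reference pair as an [AbsTopIII] Def. 3.1 (ii) pair `RefLocalDatum.toPair` (`Π_v ↷ O^▷_v` with open
  stabilisers) and the dictionary `GMData.Iso F_v F_v → GaloisMonoidPair.Iso` (forget the topology of `O^▷_v`);
  **`liftUnique_of_pairIsoDeterminedByGalois`** — the uniqueness half FOLLOWS from [AbsTopIII] Prop. 3.2 (iv),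
  injectivity (`PairIsoDeterminedByGalois`), once `F_v` is an MLF-Galois `TM`-pair; **`liftExists_of_galoisIsoLifts`**
  — the existence half follows from Prop. 3.2 (iv), bijectivity in the author's corrected form
  (`GaloisIsoLiftsToTMPairIso H`, pairs "of hyperbolic orbicurve type" `H`), the characteristicity of the
  arithmetic kernel `Ker(Π_v ↠ G_v)` under topological automorphisms (`IsTopCharacteristic`; [IUTchII] Prop. 1.6:
  "the [group-theoretic! — cf., e.g., [AbsAnab], Lemma 1.3.8] subgroup") and the continuity of the lifted monoid
  isomorphism (`hcont`, see (ii) below); `uniqueLifting_of_prop32iv` assembles both.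

HONEST SCOPE. (i) [AbsTopIII] Prop. 4.2 (i) (archimedean places) has no counterpart: `RefLocalDatum` is
nonarchimedean (LanaStrips modelling note (iii)). (ii) LANA Def. 3.7.1 isomorphisms of GM-data are homeomorphisms
on the monoid `M = O^▷_v` (subspace topology of `K̄_v`), whereas L4 types [AbsTopIII] Def. 3.1 (ii) pairs with the
topology of `M` omitted (Rmk. 3.1.1 p. 70); the passage is the explicit hypothesis `hcont` of the existence half —
the uniqueness half needs nothing of the kind. (iii) The predicate "of hyperbolic orbicurve type" is L4's
parameter `H` (scheme-theoretic origin of `Π_v ↠ G_v`, seat abc-iut-L4-t1); the named facts are [AbsTopIII]'s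
(refereed, 2015; erratum item (5) of the author's 2019 Comments folded in by L4), typed as `Prop`s and NOT proved in
the tree. [cite: LANA2026Report, §5.3 (a) p. 29, §3.10 p. 23, Rem. 3.10.1 p. 22]
[cite: MochizukiAbsTopIII2015, Proposition 3.2 (iv) p.72] NOT here: any judgement.
-/

noncomputable section

namespace Summit.ABC
namespace IUTFork

open Literature.AnabelianGeometry.AbsoluteAnabelian
open Topology

/-! ## 0. Equality of isomorphisms of GM-data -/

namespace GMData.Iso

variable {X Y Z : GMData}

/-- Two isomorphisms of GM-data with the same components are equal (the third field is a proposition).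
[cite: LANA2026Report, Def. 3.7.1 p. 20] -/
theorem ext' {Φ Ψ : GMData.Iso X Y} (hG : Φ.eG = Ψ.eG) (hM : Φ.eM = Ψ.eM) : Φ = Ψ := by
  cases Φ; cases Ψ; cases hG; cases hM; rfl

/-- `eG` of a composite, evaluated. [folklore] -/
theorem trans_eG_apply (φ : GMData.Iso X Y) (ψ : GMData.Iso Y Z) (g : X.G) :
    (φ.trans ψ).eG g = ψ.eG (φ.eG g) := rfl

/-- `eM` of a composite, evaluated. [folklore] -/
theorem trans_eM_apply (φ : GMData.Iso X Y) (ψ : GMData.Iso Y Z) (m : X.M) :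
    (φ.trans ψ).eM m = ψ.eM (φ.eM m) := rfl

/-- `eG` of an inverse, evaluated. [folklore] -/
theorem symm_eG_apply (φ : GMData.Iso X Y) (g : Y.G) : φ.symm.eG g = φ.eG.symm g := rfl

/-- `eM` of an inverse, evaluated. [folklore] -/
theorem symm_eM_apply (φ : GMData.Iso X Y) (m : Y.M) : φ.symm.eM m = φ.eM.symm m := rfl

end GMData.Iso

/-! ## 1. "Unique lifting" at the reference datum `F_v = (Π_v ↷ O^▷_v)` -/

namespace RefLocalDatum

variable (L : RefLocalDatum)

/-- **Existence half of the unique lifting AT THE REFERENCE DATUM**: every automorphism of the topological group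
`Π_v` (= the `D`-prime-strip datum `D_v`) extends to an automorphism of the GM-data `F_v = (Π_v ↷ O^▷_v)`.
[cite: LANA2026Report, §5.3 (a) p. 29] -/
@[cite "LANA2026Report" "§5.3 (a) p. 29"]
def LiftExists : Prop := ∀ f : L.Fhol.G ≃ₜ* L.Fhol.G, ∃ Φ : GMData.Iso L.Fhol L.Fhol, Φ.eG = f

/-- **Uniqueness half of the unique lifting AT THE REFERENCE DATUM**: an automorphism of `F_v` is determined by
its `Π_v`-component. [cite: LANA2026Report, §5.3 (a) p. 29] -/
@[cite "LANA2026Report" "§5.3 (a) p. 29"]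
def LiftUnique : Prop := ∀ Φ Ψ : GMData.Iso L.Fhol L.Fhol, Φ.eG = Ψ.eG → Φ = Ψ

end RefLocalDatum

/-! ## 2. Reduction of `UniqueLifting ref` to the reference datum at each place -/

section Reduction

variable {V : Type} {ref : V → RefLocalDatum}

/-- Conjugation identity used twice: an isomorphism `Θ : A ⥲ B` is recovered from `φ⁻¹ ∘ Θ ∘ φ'`
(`φ : A ⥲ R`, `φ' : B ⥲ R`) by conjugating back. [folklore] -/
private theorem conj_back {A B R : GMData} (φ : GMData.Iso A R) (φ' : GMData.Iso B R) (Θ : GMData.Iso A B) :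
    Θ = (φ.trans (φ.symm.trans (Θ.trans φ'))).trans φ'.symm := by
  refine GMData.Iso.ext' ?_ ?_
  · ext g
    simp only [GMData.Iso.trans_eG_apply, GMData.Iso.symm_eG_apply, ContinuousMulEquiv.symm_apply_apply]
  · ext m
    simp only [GMData.Iso.trans_eM_apply, GMData.Iso.symm_eM_apply, ContinuousMulEquiv.symm_apply_apply]

/-- **`UniqueLifting` from the reference datum**: if at every place the reference GM-data `F_v` has both
lifting properties, then any isomorphism of `D`-prime-strips lifts uniquely to the `F`-prime-strips — lifting
between COPIES is lifting at the reference conjugated by the copy isomorphisms (§3.10 p. 23 "abstractly isomorphic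
to the collection of these local data"). [cite: LANA2026Report, §5.3 (a) p. 29, §3.10 p. 23] -/
theorem uniqueLifting_of_ref (hE : ∀ v, (ref v).LiftExists) (hU : ∀ v, (ref v).LiftUnique) :
    UniqueLifting ref := by
  intro F F' δ
  -- copy isomorphisms to the reference data
  have φ : ∀ v, GMData.Iso (F.X v) (ref v).Fhol := fun v => Classical.choice (F.isCopy v).nonempty
  have φ' : ∀ v, GMData.Iso (F'.X v) (ref v).Fhol := fun v => Classical.choice (F'.isCopy v).nonempty
  -- lifts, at the reference data, of the transported group isomorphisms `φ_v⁻¹ ≫ δ_v ≫ φ'_v` of `Π_v`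
  choose Ψ hΨ using fun v => hE v (((φ v).eG.symm.trans (δ v)).trans (φ' v).eG)
  refine ⟨fun v => ((φ v).trans (Ψ v)).trans (φ' v).symm, fun v => ?_, fun Φ hΦ => ?_⟩
  · -- the lift lies over `δ`
    refine ContinuousMulEquiv.ext fun g => ?_
    have h1 : (Ψ v).eG ((φ v).eG g) = (((φ v).eG.symm.trans (δ v)).trans (φ' v).eG) ((φ v).eG g) := by
      rw [hΨ v]
    calc (((φ v).trans (Ψ v)).trans (φ' v).symm).eG g
        = (φ' v).eG.symm ((Ψ v).eG ((φ v).eG g)) := rfl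
      _ = (φ' v).eG.symm ((((φ v).eG.symm.trans (δ v)).trans (φ' v).eG) ((φ v).eG g)) := by rw [h1]
      _ = _ := ((φ' v).eG.symm_apply_apply _).trans (congrArg (δ v) ((φ v).eG.symm_apply_apply g))
  · have hΦ' : ∀ v, (Φ v).eG = δ v := hΦ
    funext v
    -- conjugate `Φ v` back to the reference datum and use uniqueness there
    have hconj : (φ v).symm.trans ((Φ v).trans (φ' v)) = Ψ v := by
      refine hU v _ _ (ContinuousMulEquiv.ext fun g => ?_)
      rw [hΨ v]
      exact congrArg (fun X : (F.X v).G ≃ₜ* (F'.X v).G => (φ' v).eG (X ((φ v).eG.symm g))) (hΦ' v)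
    rw [conj_back (φ v) (φ' v) (Φ v), hconj]

/-- **Uniqueness at the reference datum from `UniqueLifting`**: apply it to the standard strip and the family
of group automorphisms that is `Φ.eG` at `v` and the identity elsewhere. [cite: LANA2026Report, §5.3 (a) p. 29] -/
theorem liftUnique_of_uniqueLifting (h : UniqueLifting ref) (v : V) : (ref v).LiftUnique := by
  classical
  intro Φ Ψ hG
  let S : FPrimeStrip ref := GMFamily.std (fun v => (ref v).Fhol)
  -- the family of group isomorphisms: `Φ.eG` at `v`, identity elsewhere
  let δ : S.toD.Iso S.toD := Function.update (fun w => ContinuousMulEquiv.refl (ref w).Fhol.G) v Φ.eG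
  -- the two candidate lifts: `Φ`, resp. `Ψ`, at `v`, identity elsewhere
  let A : S.Iso S := Function.update (fun w => GMData.Iso.refl (ref w).Fhol) v Φ
  let B : S.Iso S := Function.update (fun w => GMData.Iso.refl (ref w).Fhol) v Ψ
  have hA : ∀ w, (A w).eG = δ w := by
    intro w
    by_cases hw : w = v
    · subst hw
      simp only [A, δ, Function.update_self]
    · simp only [A, δ, Function.update_of_ne hw]
      rfl
  have hB : ∀ w, (B w).eG = δ w := by
    intro w
    by_cases hw : w = v
    · subst hw
      simp only [B, δ, Function.update_self, ← hG]
    · simp only [B, δ, Function.update_of_ne hw]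
      rfl
  obtain ⟨Χ, -, huniq⟩ := h S S δ
  have hAB : A = B := (huniq A hA).trans (huniq B hB).symm
  have key : A v = B v := congrFun hAB v
  simp only [A, B, Function.update_self] at key
  exact key

/-- **Existence at the reference datum from `UniqueLifting`** (same device). [cite: LANA2026Report, §5.3 (a) p. 29] -/
theorem liftExists_of_uniqueLifting (h : UniqueLifting ref) (v : V) : (ref v).LiftExists := by
  classical
  intro f
  let S : FPrimeStrip ref := GMFamily.std (fun v => (ref v).Fhol)
  let δ : S.toD.Iso S.toD := Function.update (fun w => ContinuousMulEquiv.refl (ref w).Fhol.G) v f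
  obtain ⟨Χ, hΧ, -⟩ := h S S δ
  have hv : (Χ v).eG = f := by
    rw [hΧ v]
    simp only [δ, Function.update_self]
  exact ⟨Χ v, hv⟩

/-- **`UniqueLifting ref` ⟺ both lifting properties at every reference datum** — the hypothesis of
`LanaLogTheta.lean` is EXACTLY a property of the local data `F_v = (Π_v ↷ O^▷_v)`, place by place (group-level twin
of L5-t4's `FKit.isomFtoDBijective_iff_model` for [IUTchI] Cor. 5.3 (ii)).
[cite: LANA2026Report, §5.3 (a) p. 29, §3.10 p. 23] -/
theorem uniqueLifting_iff_ref :
    UniqueLifting ref ↔ (∀ v, (ref v).LiftExists) ∧ ∀ v, (ref v).LiftUnique :=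
  ⟨fun h => ⟨liftExists_of_uniqueLifting h, liftUnique_of_uniqueLifting h⟩, fun h => uniqueLifting_of_ref h.1 h.2⟩

variable [Fintype V] {bad : Finset V}

/-- **The log-link is unique over its étale isomorphism as soon as the UNIQUENESS half holds at every reference
datum** ("one obtains a unique lift `log`": only uniqueness is used, cf. `LogLink.lift_unique`).
[cite: LANA2026Report, §5.3 (a) p. 29] -/
theorem LogLink.lift_unique_of_liftUnique (hU : ∀ v, (ref v).LiftUnique) {H H' : HodgeTheater ref bad}
    (L L' : LogLink H H') (h : L.etaleIso = L'.etaleIso) : L.lift = L'.lift := by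
  -- conjugate to the reference datum exactly as in `uniqueLifting_of_ref`
  have φ : ∀ v, GMData.Iso (H.F.X v) (ref v).Fhol := fun v => Classical.choice (H.F.isCopy v).nonempty
  have φ' : ∀ v, GMData.Iso (H'.F.X v) (ref v).Fhol := fun v => Classical.choice (H'.F.isCopy v).nonempty
  funext v
  have key : (φ v).symm.trans ((L.lift v).trans (φ' v)) = (φ v).symm.trans ((L'.lift v).trans (φ' v)) := by
    refine hU v _ _ (ContinuousMulEquiv.ext fun g => ?_)
    have h1 : (L.lift v).eG = (L'.lift v).eG := by rw [L.lift_etale v, L'.lift_etale v, h]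
    calc ((φ v).symm.trans ((L.lift v).trans (φ' v))).eG g
        = (φ' v).eG ((L.lift v).eG ((φ v).eG.symm g)) := rfl
      _ = (φ' v).eG ((L'.lift v).eG ((φ v).eG.symm g)) := by rw [h1]
      _ = ((φ v).symm.trans ((L'.lift v).trans (φ' v))).eG g := rfl
  rw [conj_back (φ v) (φ' v) (L.lift v), conj_back (φ v) (φ' v) (L'.lift v), key]

end Reduction

/-! ## 3. The reference pair as an [AbsTopIII] Def. 3.1 (ii) pair; Prop. 3.2 (iv) by name -/

namespace RefLocalDatum

variable (L : RefLocalDatum)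

/-- The stabiliser in `Π_v` of `a ∈ O^▷_v` (action through `Π_v ↠ G_v`) is the preimage of its stabiliser in
`G_v`. [cite: LANA2026Report, §3.10 p. 22] -/
theorem stabilizer_holAction_eq (a : intMonoid L.w) :
    @MulAction.stabilizer L.P (intMonoid L.w) _ L.holAction.toMulAction a =
      (MulAction.stabilizer L.G a).comap (L.ρ : L.P →* L.G) := by
  ext g
  rfl

/-- **`F_v = (Π_v ↷ O^▷_v)` as a pair of [AbsTopIII] Def. 3.1 (ii)** (L4's `GaloisMonoidPair`: topological group,
commutative monoid, action by monoid automorphisms with open point stabilisers), given that `G_v` acts on `O^▷_v`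
with open stabilisers (Krull topology; automatic for an absolute Galois group acting on algebraic elements).
The topology of `O^▷_v` is forgotten (module docstring (ii)). [cite: MochizukiAbsTopIII2015, Definition 3.1 (ii) p.67]
[cite: LANA2026Report, §3.10 Table 1 p. 22] -/
abbrev toPair (hst : ∀ a : intMonoid L.w, IsOpen (MulAction.stabilizer L.G a : Set L.G)) : GaloisMonoidPair.{0} :=
  { Pi := L.P
    M := intMonoid L.w
    instAction := L.holAction
    isOpen_stabilizer := fun a => by
      rw [L.stabilizer_holAction_eq a, Subgroup.coe_comap]
      exact (hst a).preimage (map_continuous L.ρ) }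

variable (hst : ∀ a : intMonoid L.w, IsOpen (MulAction.stabilizer L.G a : Set L.G))

/-- **The arithmetic kernel of the pair** ("the quotient `Π ↠ G` determined by the action of `Π` on `M`",
Def. 3.1 (ii)): `g` lies in it iff `ρ(g)` acts trivially on `O^▷_v` — so it is `Ker(Π_v ↠ G_v)` itself when `G_v`
acts faithfully on `O^▷_v` (`toPair_actionKer_eq_ker`). [cite: MochizukiAbsTopIII2015, Definition 3.1 (ii) p.67] -/
theorem mem_toPair_actionKer_iff (g : L.P) :
    g ∈ (L.toPair hst).actionKer ↔ ∀ a : intMonoid L.w, L.ρ g • a = a :=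
  MulEquiv.ext_iff

/-- If `G_v ↷ O^▷_v` is faithful, the arithmetic kernel of the pair is `Ker(Π_v ↠ G_v)`.
[cite: MochizukiAbsTopIII2015, Definition 3.1 (ii) p.67] -/
theorem toPair_actionKer_eq_ker (hf : ∀ σ : L.G, (∀ a : intMonoid L.w, σ • a = a) → σ = 1) :
    (L.toPair hst).actionKer = (L.ρ : L.P →* L.G).ker := by
  ext g
  rw [L.mem_toPair_actionKer_iff hst, MonoidHom.mem_ker]
  refine ⟨fun h => hf _ h, fun h a => ?_⟩
  have h' : L.ρ g = 1 := h
  rw [h', one_smul]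

/-- **Dictionary**: an isomorphism of the GM-data `F_v ⥲ F_v` (LANA Def. 3.7.1: bi-continuous on both portions)
IS an isomorphism of the pair (`GaloisMonoidPair.Iso`: the topology of `O^▷_v` forgotten).
[cite: MochizukiAbsTopIII2015, Definition 3.1 (ii) p.67] [cite: LANA2026Report, Def. 3.7.1 p. 20] -/
def isoToPairIso (Φ : GMData.Iso L.Fhol L.Fhol) : GaloisMonoidPair.Iso (L.toPair hst) (L.toPair hst) where
  isoPi := Φ.eG
  isoM := Φ.eM.toMulEquiv
  smul_comm g a := Φ.map_smul g a

/-- The dictionary keeps the group component … [cite: LANA2026Report, Def. 3.7.1 p. 20] -/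
theorem isoToPairIso_isoPi (Φ : GMData.Iso L.Fhol L.Fhol) : (L.isoToPairIso hst Φ).isoPi = Φ.eG := rfl

/-- … and the monoid component (as a bare isomorphism). [cite: LANA2026Report, Def. 3.7.1 p. 20] -/
theorem isoToPairIso_isoM_apply (Φ : GMData.Iso L.Fhol L.Fhol) (a : intMonoid L.w) :
    (L.isoToPairIso hst Φ).isoM a = Φ.eM a := rfl

/-- **The uniqueness half of the unique lifting FROM [AbsTopIII] Prop. 3.2 (iv) (injectivity)**: if `F_v` is an
MLF-Galois `TM`-pair and `Isom((Π ↷ M_TM), (Π* ↷ M*_TM)) ↪ Isom(Π, Π*)` (L4's named fact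
`PairIsoDeterminedByGalois`, NOT proved in the tree), then an automorphism of the GM-data `F_v` is determined by
its `Π_v`-component. [cite: MochizukiAbsTopIII2015, Proposition 3.2 (iv) p.72] [cite: LANA2026Report, §5.3 (a) p. 29] -/
theorem liftUnique_of_pairIsoDeterminedByGalois (hMLF : IsMLFGaloisMonoidPair .TM (L.toPair hst))
    (hdet : PairIsoDeterminedByGalois) : L.LiftUnique := by
  intro Φ Ψ hG
  have hM : (L.isoToPairIso hst Φ).isoM = (L.isoToPairIso hst Ψ).isoM :=
    hdet _ _ hMLF hMLF (L.isoToPairIso hst Φ) (L.isoToPairIso hst Ψ) hG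
  exact GMData.Iso.ext' hG (ContinuousMulEquiv.ext fun a => MulEquiv.congr_fun hM a)

/-- **The existence half of the unique lifting FROM [AbsTopIII] Prop. 3.2 (iv) (bijectivity, author's corrected
form)**: if `F_v` is an MLF-Galois `TM`-pair of hyperbolic orbicurve type (`H`), every quotient-compatible
topological isomorphism of `Π`'s lifts to the pairs (L4's named fact `GaloisIsoLiftsToTMPairIso H`, NOT proved in
the tree), the arithmetic kernel of `F_v` is characteristic in `Π_v` ("[group-theoretic! — cf., e.g., [AbsAnab],
Lemma 1.3.8]", L2's `IsTopCharacteristic`), and lifted monoid isomorphisms are homeomorphisms of `O^▷_v` (`hcont`,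
module docstring (ii)), then every topological automorphism of `Π_v` extends to the GM-data `F_v`.
[cite: MochizukiAbsTopIII2015, Proposition 3.2 (iv) p.72] [cite: LANA2026Report, §5.3 (a) p. 29] -/
theorem liftExists_of_galoisIsoLifts {H : GaloisMonoidPair.{0} → Prop}
    (hMLF : IsMLFGaloisMonoidPair .TM (L.toPair hst)) (hH : H (L.toPair hst))
    (hlift : GaloisIsoLiftsToTMPairIso H)
    (hker : Literature.AnabelianGeometry.EtaleTheta.IsTopCharacteristic L.P (L.toPair hst).actionKer)
    (hcont : ∀ e : GaloisMonoidPair.Iso (L.toPair hst) (L.toPair hst), Continuous e.isoM ∧ Continuous e.isoM.symm) :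
    L.LiftExists := by
  intro f
  obtain ⟨e, he⟩ := hlift _ _ hMLF hMLF hH hH f (hker f)
  let eM : L.Fhol.M ≃ₜ* L.Fhol.M :=
    { e.isoM with continuous_toFun := (hcont e).1, continuous_invFun := (hcont e).2 }
  have heM : ∀ a, eM a = e.isoM a := fun _ => rfl
  refine ⟨⟨f, eM, fun g a => ?_⟩, rfl⟩
  have h := e.smul_comm g a
  rw [he] at h
  rw [heM, heM]
  exact h

/-- **`UniqueLifting ref` FROM [AbsTopIII] Prop. 3.2 (iv) BY NAME, place by place** (assembling §2 and the two
halves): the hypothesis of `LanaLogTheta.lean` holds for reference data whose `F_v` are MLF-Galois `TM`-pairs of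
hyperbolic orbicurve type with characteristic arithmetic kernels, granted L4's named facts
`PairIsoDeterminedByGalois`, `GaloisIsoLiftsToTMPairIso H` and the continuity clause. What [IUTchI] Cor. 5.3 (ii)
adds at archimedean places ([AbsTopIII] Prop. 4.2 (i)) has no counterpart here (module docstring (i)).
[cite: MochizukiAbsTopIII2015, Proposition 3.2 (iv) p.72] [cite: LANA2026Report, §5.3 (a) p. 29] -/
theorem uniqueLifting_of_prop32iv {V : Type} (ref : V → RefLocalDatum)
    (hst : ∀ v (a : intMonoid (ref v).w), IsOpen (MulAction.stabilizer (ref v).G a : Set (ref v).G))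
    {H : GaloisMonoidPair.{0} → Prop}
    (hMLF : ∀ v, IsMLFGaloisMonoidPair .TM ((ref v).toPair (hst v))) (hH : ∀ v, H ((ref v).toPair (hst v)))
    (hdet : PairIsoDeterminedByGalois) (hlift : GaloisIsoLiftsToTMPairIso H)
    (hker : ∀ v, Literature.AnabelianGeometry.EtaleTheta.IsTopCharacteristic (ref v).P
      ((ref v).toPair (hst v)).actionKer)
    (hcont : ∀ v (e : GaloisMonoidPair.Iso ((ref v).toPair (hst v)) ((ref v).toPair (hst v))),
      Continuous e.isoM ∧ Continuous e.isoM.symm) :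
    UniqueLifting ref :=
  uniqueLifting_of_ref
    (fun v => (ref v).liftExists_of_galoisIsoLifts (hst v) (hMLF v) (hH v) hlift (hker v) (hcont v))
    (fun v => (ref v).liftUnique_of_pairIsoDeterminedByGalois (hst v) (hMLF v) hdet)

/-- **The log-link's uniqueness FROM [AbsTopIII] Prop. 3.2 (iv), injectivity, alone** (no orbicurve-type,
characteristicity or continuity clause): granted `PairIsoDeterminedByGalois`, two log-links between Hodge theaters
on reference data whose `F_v` are MLF-Galois `TM`-pairs that share their étale isomorphism share their lift.
[cite: MochizukiAbsTopIII2015, Proposition 3.2 (iv) p.72] [cite: LANA2026Report, §5.3 (a) p. 29] -/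
theorem logLink_lift_unique_of_pairIsoDeterminedByGalois {V : Type} [Fintype V] {ref : V → RefLocalDatum}
    {bad : Finset V}
    (hst : ∀ v (a : intMonoid (ref v).w), IsOpen (MulAction.stabilizer (ref v).G a : Set (ref v).G))
    (hMLF : ∀ v, IsMLFGaloisMonoidPair .TM ((ref v).toPair (hst v))) (hdet : PairIsoDeterminedByGalois)
    {HT HT' : HodgeTheater ref bad} (Lg Lg' : LogLink HT HT') (h : Lg.etaleIso = Lg'.etaleIso) :
    Lg.lift = Lg'.lift :=
  LogLink.lift_unique_of_liftUnique
    (fun v => (ref v).liftUnique_of_pairIsoDeterminedByGalois (hst v) (hMLF v) hdet) Lg Lg' h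

end RefLocalDatum

end IUTFork

end Summit.ABC

end
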